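import Literature.AlgebraicGeometry.Frobenioids.ArchimedeanPointBaseThm36
import Literature.AlgebraicGeometry.Frobenioids.Thm36SubInstancesB
import Mathlib.CategoryTheory.Discrete.Basic
import Mathlib.CategoryTheory.Comma.Over.Basic
import HarnessLib

/-!
# Frobenioids II, Theorem 3.6 for THE archimedean Frobenioid `C_v` of [IUTchI] Example 3.4 (i) —
# hypothesis-free instances over the one-morphism base (part B: (i) typology, (ix), (x))

Mochizuki, *The geometry of Frobenioids II: poly-Frobenioids*, Kyushu J. Math. **62** (2008) 401–460, §3,
Theorem 3.6 pp. 36–38 [cite: MochizukiFrdII2008, Thm 3.6 pp.36-38], at the data of *Inter-universal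
Teichmüller theory I*, Example 3.4 (i), kurims text (May 2020) p. 80: "`C_v` … the archimedean Frobenioid as
in [FrdII], Example 3.3, (ii), where we take the base category to be the one-morphism category determined by
`Spec(K_v)`" [cite: Mochizuki2012, Ex 3.4 (i) p.80] — i.e. `ArchFrd.Cpt = C ptBase` of
`ArchimedeanPointBase.lean` (seat abc-iut-L1-t6), a Frobenioid WITHOUT residual hypothesis
(`ArchFrd.Cpt.isFrobenioid`).

This PROOF-ONLY file (abc-iut cell, L1 row M13 capstone; seat abc-iut-w4-d074) specialises the `Λ`-indexed
instance statements of `ArchimedeanTheoremsInstances.lean` (seat abc-iut-L1-t9), DISCHARGED for every base in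
`Thm36SubInstancesA/B.lean` at THE completions `C^ℚ := C^pf`, `C^ℝ := C^rlf` (`Thm36Sub.pfCompletion`,
`Thm36Sub.rlfCompletion`), to the base `ptBase`, where the standing hypothesis "`C` is a Frobenioid" is a
THEOREM — part B (part A = `ArchimedeanPointBaseThm36.lean`): Thm. 3.6 (i) typology [«`Aut`-ample, `Aut^sub`-ample,
`End`-ample, metrically trivial, not group-like»], (ix), (x) for `C_v^Λ`, `Λ ∈ {ℤ, ℚ, ℝ}`, with NO hypothesis
left; the premises of (ix), (x) about the base ("`D` of strongly indissectible type [and complexifiable or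
`Λ ≠ ℤ`]", "`D` slim") are DISCHARGED for the one-morphism base (part A's `isOfStronglyIndissectibleType_
discretePUnit`, `ptBase_isComplexifiable`, `isSlim_discretePUnit`), giving the printed CONCLUSIONS outright:
every `(C_v^Λ)^istr` is of strongly indissectible type; `C_v` and `C_v^ℝ` are slim.  Nothing is (re)defined; no side is taken on
[IUTchIII] Cor. 3.12 (the content is the classical [FrdII] §3).
-/

noncomputable section

namespace Literature.AlgebraicGeometry.Frobenioids

open CategoryTheory

namespace ArchFrd

namespace Thm36Sub

/-! ### Theorem 3.6 (i) typology, (ix), (x) for `C_v^Λ` — no hypothesis -/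

/-- **Thm. 3.6 (i)** for `C_v`: "`C^Λ` is of `Aut`-ample, `Aut^sub`-ample, `End`-ample and metrically trivial
type, but not of group-like type", all `Λ`. [cite: MochizukiFrdII2008, Thm 3.6 (i) p.36] -/
theorem cpt_thm36i_ampleTypes :
    Thm36i_ampleTypes_C ptBase (pfCompletion ptBase Cpt.isFrobenioid) (rlfCompletion ptBase) :=
  thm36i_ampleTypes_C_holds ptBase Cpt.isFrobenioid

/-- **Thm. 3.6 (ix)** for `C_v^Λ` and `A_v` (`ix_Q_holds`, seat abc-iut-w5-d036; `ix_R_holds`, seat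
abc-iut-L1-d5; `Λ = ℤ` and `A` by seats L5-d3 / w4-d027). [cite: MochizukiFrdII2008, Thm 3.6 (ix) p.38] -/
theorem cpt_thm36ix : Thm36ix_CA ptBase (pfCompletion ptBase Cpt.isFrobenioid) (rlfCompletion ptBase) :=
  thm36ix_CA_holds ptBase Cpt.isFrobenioid

/-- **Thm. 3.6 (ix), CONCLUSION for `C_v^Λ`**: `(C_v^Λ)^istr` is of strongly indissectible type for every
`Λ` — the premises "`D` of strongly indissectible type" and "`D` complexifiable (or `Λ ≠ ℤ`)" hold for the
one-morphism base at `Spec ℂ`. [cite: MochizukiFrdII2008, Thm 3.6 (ix) p.38] -/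
theorem cpt_istr_isOfStronglyIndissectibleType (Λ : MonoidType) :
    IsOfStronglyIndissectibleType
      (PreFrobenioid.isotropicObjects
        (archFrobenioid ptBase (pfCompletion ptBase Cpt.isFrobenioid) (rlfCompletion ptBase) Λ).str).FullSubcategory :=
  cpt_thm36ix.1 Λ isOfStronglyIndissectibleType_discretePUnit fun h => absurd ptBase_isComplexifiable h

/-- **Thm. 3.6 (x)** for `C_v^Λ` and `A_v`. [cite: MochizukiFrdII2008, Thm 3.6 (x) p.38] -/
theorem cpt_thm36x : Thm36x_CA ptBase (pfCompletion ptBase Cpt.isFrobenioid) (rlfCompletion ptBase) :=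
  thm36x_CA_holds ptBase _

/-- **Thm. 3.6 (x), CONCLUSION at `Λ = ℤ`**: `C_v` is slim (the one-morphism base is slim).
[cite: MochizukiFrdII2008, Thm 3.6 (x) p.38] -/
theorem cpt_isSlim : IsSlim Cpt :=
  cpt_thm36x.1 .Z isSlim_discretePUnit fun h => by cases h

/-- **Thm. 3.6 (x), CONCLUSION at `Λ = ℝ`**: `C_v^ℝ = C_v^rlf` is slim. [cite: MochizukiFrdII2008, Thm 3.6 (x) p.38] -/
theorem cpt_isSlim_rlf : IsSlim (rlfCat ptBase) :=
  cpt_thm36x.1 .R isSlim_discretePUnit fun h => by cases h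

end Thm36Sub

end ArchFrd

end Literature.AlgebraicGeometry.Frobenioids

end
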